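/-
Copyright: statement-level skeleton of a published paper (lit-balaban cell, Phase-2 proof seat p25, gen 21). No proof
claims beyond what the kernel checks below.
-/
import Literature.MathematicalPhysics.QuantumFieldTheory.BalabanImbrieJaffe1984to88.BIJ88WalkLocalCount312

/-!
# `BalabanImbrieJaffe1984to88.BIJ88WalkLocalCountW312` — T. Bałaban, J. Imbrie, A. Jaffe, *Effective action and
cluster properties of the abelian Higgs model*, Commun. Math. Phys. **114** (1988) 257–315 [BalabanImbrieJaffe1988],
§5.14 p. 310 [PDF 54] (x2 render `lit-balaban-r16/renders/cmp114/original-p054-x2.png`), verbatim: *"We give random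
walk expansions for the propagators C^{(k)}_{Λ₁₂^{(k)}}, C^{(k)}_{Λ₁₂^{(k)}}(u_{k+1}) produced in this step. The leading
terms, with only propagators C^{(k)}_{Λ₁₂^{(k)},loc}, C^{(k)}_{Λ₁₂^{(k)},loc}(u_{k+1}), we transform further. The others,
localized in region X, have a factor of e^{−cr(e_k)|X|}. We also consider as remainders any terms
whose order in λ and e is greater than n̄."* and (after the W₆′ estimate) *"(We allow adjustments in β, α, β′, keeping
them small.)"*, and p. 311–312 [PDF 55–56] (the component expansion) — **THE LOCAL WEIGHTED COUNT ALONG A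
RUN WITH A WEIGHTED LOCALITY OF THE INTERACTION** (p25 gen 21; a MEMBER of row C2.Claim@312, owner r16, referee
ref-5; head of record `BIJ88WalkIneq312RemainderBdry.ineq312_remainder_bdry` UNCHANGED).

Gen 18's local count `BIJ88WalkLocalCount312.run_lsum_le` takes the locality of the interaction in the UNIFORM form
`#{(m,j) : ⟨C_p u, (legs m)_j⟩ ≠ 0} ≤ N₀` for EVERY piece `p`, with `W ≥ ρ₀·(rpot + N₀)`.  For a covariance split whose
pieces are localized walks `ω` (print: *"localized in region X, have a factor of e^{−cr(e_k)|X|}"*) the number of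
vertex legs coupled to `C_ω u` grows with the length of `ω`, and for a split with a NON-local piece (the tail piece of
`BIJ88WalkCovarianceSplit310.covSplit`) it is the total number of vertex legs — a VOLUME: a uniform `N₀` is the wrong
currency.  Here the count is re-proved with the locality WEIGHTED by the piece weights: `Σ_{p : C_p u ≠ 0} ρ_p ≤ ρ₀`
as before and `Σ_p ρ_p·#{(m,j) : ⟨C_p u, (legs m)_j⟩ ≠ 0} ≤ ρ₁` for every admissible direction `u`, with
`W ≥ ρ₀·rpot + ρ₁` (`run_lsum_le_W`); gen 18's statement is the case `ρ₁ = ρ₀·N₀` (`run_lsum_le_of_uniform`).  For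
print's walks, `Σ_ω e^{−c|ω|}·|ω|·(legs per cube) < ∞` uniformly in the volume.

statement-level skeleton of published theorems with citation tags; proofs where landed; nothing here is a claim
about the Yang–Mills mass gap

PDF held: `paper:balaban1988-cmp114-bij-abelian-higgs-effective-action` (journal page = PDF page + 256); pp. 310–312
= PDF 54–56.

CITATION HEADER (lean-in-tree rule).  lit-balaban cell (HOME `run/shared/lean/pub/lit-balaban/`), Phase 2, seat p25
gen 21; row **C2.Claim@312** of `HOME/lit-balaban-r16/ROWS-C2-part2.md`.  USED BY NAME, nothing restated:
`BIJ88WalkRun311.{run, rpot, WGrp, WOut, rpot_*, run_of_complete, run_of_not_complete}`,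
`BIJ88WalkLocalCount312.{nds, nds_nonneg, nds_scale_le, nds_scale_zero, nds_push_le, nds_push_zero, nds_bump, run_lsum_le}`
(p25 gen 18), `BIJ88LabelledRun311.{sum_map_bind, sum_map_fbind, sum_map_mbind}`, `BIJ88VertexComponents311.maxArity`.

## What is proved (0 `sorry`, standard axioms, no new `Prop` facts; theorems only, no definitions)

* **`run_lsum_le_W`** (THE WEIGHTED LOCAL COUNT ALONG A RUN): `Σ_{o nondegenerate} (Π_{p∈o.dp} ρ p)·W^{rpot o} ≤ W^{rpot g}`
  under `Σ_{p∋u} ρ_p ≤ ρ₀`, `Σ_p ρ_p N_p(u) ≤ ρ₁`, `W ≥ 1`, `ρ₀·rpot + ρ₁ ≤ W`;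
* `run_lsum_le_of_uniform` (gen 18's hypotheses `N_p(u) ≤ N₀`, `ρ₀(rpot + N₀) ≤ W` imply these: consistency).
HONEST SCOPE: (a) bookkeeping along ONE run; the expansion-level telescoping and the chain above it
(`BIJ88WalkLocalTermCount312`, `…RemainderActivity(N)312`, the head) still carry the uniform `N₀` — re-threading them on
this count is a separate member (not done here); (b) the weights `ρ`, `ρ₀`, `ρ₁` are letters (print: the walks'
`e^{−cr(e_k)|X|}`), no walk expansion is instantiated here; (c) contraction-graph components as in gen 18.  NOT summit
progress; NOT continuum; NOT Clay.  Imports `BIJ88WalkLocalCount312` only; modifies nothing.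
-/

noncomputable section

namespace Literature.MathematicalPhysics.QuantumFieldTheory.BalabanImbrieJaffe1984to88.BIJ88WalkLocalCountW312

open Classical Matrix Finset
open scoped BigOperators
open BIJ88VertexComponents311 (maxArity)
open BIJ88LabelledRun311 (fbind mbind sum_map_bind sum_map_fbind sum_map_mbind)
open BIJ88WalkRun311 BIJ88WalkRunEnv311 BIJ88WalkGeometry311 BIJ88WalkLocalCount312

variable {S : Type} [Fintype S] {ι : Type} [Fintype ι] {κ : Type} [LinearOrder κ] {P : Type} [Fintype P]

section Run

variable {Cov : P → Matrix S S ℝ} {trig : P → Bool} {f : S → ℝ} {c : ι → ℝ} {legs : ι → List (S → ℝ)}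
  {obs : κ → List (S → ℝ)} {M : ℕ} {ρ : P → ℝ} {Dir : Set (S → ℝ)} {ρ₀ ρ₁ : ℝ}

/-- **THE WEIGHTED LOCAL COUNT ALONG A RUN**: observables and vertex legs with directions in `Dir`; piece weights
`ρ ≥ 0` with `Σ_{p : C_p u ≠ 0} ρ p ≤ ρ₀` for every `u ∈ Dir` (only the pieces SEEING the leg) and the WEIGHTED
locality of the interaction `Σ_p ρ p · #{(m,j) : ⟨C_p u, (legs m)_j⟩ ≠ 0} ≤ ρ₁` (each piece pays for the vertex legs it
couples to, with its own weight); `W ≥ 1` with `ρ₀·rpot + ρ₁ ≤ W`.  Then, pending legs in `Dir`,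
`Σ_{o ∈ run g rest done, o nondegenerate} (Π_{p∈o.dp} ρ p)·W^{rpot o} ≤ W^{rpot g}`.
[cite: BalabanImbrieJaffe1988, §5.14 p.310–312] -/
theorem run_lsum_le_W (hobs : ∀ j, ∀ w ∈ obs j, w ∈ Dir) (hlegs : ∀ m, ∀ w ∈ legs m, w ∈ Dir) (hρ : ∀ p, 0 ≤ ρ p)
    (hρ₀ : ∀ u ∈ Dir, (∑ p ∈ univ.filter (fun p => Cov p *ᵥ u ≠ 0), ρ p) ≤ ρ₀)
    (hρN : ∀ u ∈ Dir, (∑ p, ρ p *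
      ((∑ m, ((range (legs m).length).filter fun j => (Cov p *ᵥ u) ⬝ᵥ (legs m).getD j 0 ≠ 0).card : ℕ) : ℝ)) ≤ ρ₁) :
    ∀ (n : ℕ) (g : WGrp S κ ι P) (rest : Finset κ) (done : Multiset (WGrp S κ ι P)),
      rpot obs M (maxArity legs) g rest done < n → (∀ w ∈ g.pend, w ∈ Dir) → (∀ h ∈ done, ∀ w ∈ h.pend, w ∈ Dir) →
        ∀ W : ℝ, 1 ≤ W → ρ₀ * (rpot obs M (maxArity legs) g rest done : ℝ) + ρ₁ ≤ W →
          ((run Cov trig f c legs obs M g rest done).map (nds obs M legs ρ W)).sum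
            ≤ W ^ rpot obs M (maxArity legs) g rest done
  | 0, _, _, _, hn => fun _ _ _ _ _ => absurd hn (Nat.not_lt_zero _)
  | n + 1, g, rest, done, hn => by
    intro hg hd W hW1 hW
    have hn' : rpot obs M (maxArity legs) g rest done ≤ n := Nat.lt_succ_iff.1 hn
    have hR : 1 ≤ rpot obs M (maxArity legs) g rest done := by simp only [rpot]; omega
    have hW0 : 0 ≤ W := zero_le_one.trans hW1
    set R := rpot obs M (maxArity legs) g rest done with hRdef
    by_cases hc : g.complete M = true
    · rw [run_of_complete Cov trig f c legs obs M hc, Multiset.map_singleton, Multiset.sum_singleton, nds]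
      split_ifs
      · simp [hRdef]
      · exact pow_nonneg hW0 _
    · obtain ⟨u, L, hp⟩ := List.exists_cons_of_ne_nil (WGrp.pend_ne_nil_of_not_complete hc)
      have hnv : Multiset.card g.vxs < M := WGrp.nv_lt_of_not_complete hc
      have hu : u ∈ Dir := hg u (by rw [hp]; exact List.mem_cons_self)
      have hL : ∀ w ∈ L, w ∈ Dir := fun w hw => hg w (by rw [hp]; exact List.mem_cons_of_mem _ hw)
      have hρ₀0 : 0 ≤ ρ₀ := (Finset.sum_nonneg fun p _ => hρ p).trans (hρ₀ u hu)
      have hρ₁0 : 0 ≤ ρ₁ := (Finset.sum_nonneg fun p _ => mul_nonneg (hρ p) (Nat.cast_nonneg _)).trans (hρN u hu)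
      have hE0 : 0 ≤ W ^ (R - 1) := pow_nonneg hW0 _
      -- the induction hypothesis, for every state of smaller potential with admissible pending legs
      have IH : ∀ (g' : WGrp S κ ι P) rest' done', rpot obs M (maxArity legs) g' rest' done' < R →
          (∀ w ∈ g'.pend, w ∈ Dir) → (∀ h ∈ done', ∀ w ∈ h.pend, w ∈ Dir) →
            ((run Cov trig f c legs obs M g' rest' done').map (nds obs M legs ρ W)).sum ≤ W ^ (R - 1) :=
        fun g' rest' done' hlt hg' hd' => by
          have hlt' : (rpot obs M (maxArity legs) g' rest' done' : ℝ) ≤ R := by exact_mod_cast hlt.le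
          have hW' : ρ₀ * (rpot obs M (maxArity legs) g' rest' done' : ℝ) + ρ₁ ≤ W :=
            le_trans (add_le_add (mul_le_mul_of_nonneg_left hlt' hρ₀0) le_rfl) hW
          exact (run_lsum_le_W hobs hlegs hρ hρ₀ hρN n g' rest' done' (lt_of_lt_of_le hlt hn') hg' hd' W hW1 hW').trans
            (pow_le_pow_right₀ hW1 (by omega))
      -- one block through the piece `p` with the bracket `w`: at most `ρ p · W^{R-1}`
      have hblk : ∀ (p : P) (w : ℝ) (g' : WGrp S κ ι P) rest' done', rpot obs M (maxArity legs) g' rest' done' < R →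
          (∀ x ∈ g'.pend, x ∈ Dir) → (∀ h ∈ done', ∀ x ∈ h.pend, x ∈ Dir) →
            ((run Cov trig f c legs obs M g' rest' done').map fun o => nds obs M legs ρ W (o.scale p w)).sum
              ≤ ρ p * W ^ (R - 1) :=
        fun p w g' rest' done' hlt hg' hd' =>
          calc ((run Cov trig f c legs obs M g' rest' done').map fun o => nds obs M legs ρ W (o.scale p w)).sum
              ≤ ((run Cov trig f c legs obs M g' rest' done').map fun o => ρ p * nds obs M legs ρ W o).sum :=
                Multiset.sum_map_le_sum_map _ _ fun o _ => nds_scale_le hρ hW0 p w o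
            _ = ρ p * ((run Cov trig f c legs obs M g' rest' done').map (nds obs M legs ρ W)).sum := by
                rw [Multiset.sum_map_mul_left]
            _ ≤ ρ p * W ^ (R - 1) := mul_le_mul_of_nonneg_left (IH g' rest' done' hlt hg' hd') (hρ p)
      have hpsh : ∀ (p : P) (z : S → ℝ) (g' : WGrp S κ ι P) rest' done', rpot obs M (maxArity legs) g' rest' done' < R →
          (∀ x ∈ g'.pend, x ∈ Dir) → (∀ h ∈ done', ∀ x ∈ h.pend, x ∈ Dir) →
            ((run Cov trig f c legs obs M g' rest' done').map fun o => nds obs M legs ρ W (o.push p z)).sum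
              ≤ ρ p * W ^ (R - 1) :=
        fun p z g' rest' done' hlt hg' hd' =>
          calc ((run Cov trig f c legs obs M g' rest' done').map fun o => nds obs M legs ρ W (o.push p z)).sum
              ≤ ((run Cov trig f c legs obs M g' rest' done').map fun o => ρ p * nds obs M legs ρ W o).sum :=
                Multiset.sum_map_le_sum_map _ _ fun o _ => nds_push_le hρ hW0 p z o
            _ = ρ p * ((run Cov trig f c legs obs M g' rest' done').map (nds obs M legs ρ W)).sum := by
                rw [Multiset.sum_map_mul_left]
            _ ≤ ρ p * W ^ (R - 1) := mul_le_mul_of_nonneg_left (IH g' rest' done' hlt hg' hd') (hρ p)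
      -- a block through the piece `p` with a ZERO bracket vanishes
      have hblk0 : ∀ (p : P) (g' : WGrp S κ ι P) rest' done',
          ((run Cov trig f c legs obs M g' rest' done').map fun o => nds obs M legs ρ W (o.scale p 0)).sum = 0 :=
        fun p g' rest' done' => by simp only [nds_scale_zero, Multiset.map_const', Multiset.sum_replicate, smul_zero]
      -- admissibility of the pending legs of the successor states
      have hI1 : ∀ i, ∀ x ∈ L.eraseIdx i, x ∈ Dir := fun i x hx => hL x (List.mem_of_mem_eraseIdx hx)
      have hI2 : ∀ j i, ∀ x ∈ L ++ (obs j).eraseIdx i, x ∈ Dir := fun j i x hx => by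
        rcases List.mem_append.1 hx with hx | hx
        · exact hL x hx
        · exact hobs j x (List.mem_of_mem_eraseIdx hx)
      have hI3 : ∀ h ∈ done, ∀ i p, ∀ x ∈ (WGrp.absorb trig L g h i p).pend, x ∈ Dir := fun h hh i p x hx => by
        rcases List.mem_append.1 hx with hx | hx
        · exact hL x hx
        · exact hd h hh x (List.mem_of_mem_eraseIdx hx)
      have hI3' : ∀ h : WGrp S κ ι P, ∀ h' ∈ done.erase h, ∀ x ∈ h'.pend, x ∈ Dir :=
        fun h h' hh' => hd h' (Multiset.mem_of_mem_erase hh')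
      have hI6 : ∀ m j, ∀ x ∈ L ++ (legs m).eraseIdx j, x ∈ Dir := fun m j x hx => by
        rcases List.mem_append.1 hx with hx | hx
        · exact hL x hx
        · exact hlegs m x (List.mem_of_mem_eraseIdx hx)
      -- the weighted number of (vertex, leg) pairs coupled to the piece `p`
      set Np : P → ℕ := fun p =>
        ∑ m, ((range (legs m).length).filter fun j => (Cov p *ᵥ u) ⬝ᵥ (legs m).getD j 0 ≠ 0).card with hNp
      rw [run_of_not_complete Cov trig f c legs obs M hc hp rest done, sum_map_bind]
      refine le_trans (Finset.sum_le_sum (g := fun p =>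
        ((if Cov p *ᵥ u ≠ 0 then ρ p else 0) * (R : ℝ) + ρ p * (Np p : ℝ)) * W ^ (R - 1)) fun p _ => ?_) ?_
      · by_cases hpu : Cov p *ᵥ u = 0
        · -- a piece that does not see the leg: every outcome is degenerate
          have hite : (if Cov p *ᵥ u ≠ 0 then ρ p else 0) = 0 := by rw [if_neg]; exact fun h => h hpu
          have h0 : (0 : ℝ) ≤ ((if Cov p *ᵥ u ≠ 0 then ρ p else 0) * (R : ℝ) + ρ p * (Np p : ℝ)) * W ^ (R - 1) := by
            rw [hite, zero_mul, zero_add]; exact mul_nonneg (mul_nonneg (hρ p) (Nat.cast_nonneg _)) hE0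
          refine le_trans (le_of_eq ?_) h0
          simp only [Multiset.map_add, Multiset.sum_add, sum_map_bind, sum_map_fbind, sum_map_mbind, Multiset.map_map,
            Function.comp_def, hpu, zero_dotProduct, mul_zero, neg_zero, nds_bump, nds_scale_zero, nds_push_zero,
            Multiset.map_const', Multiset.sum_replicate, smul_zero, Finset.sum_const_zero, add_zero]
        · have hpu' : Cov p *ᵥ u ≠ 0 := hpu
          rw [if_pos hpu']
          simp only [Multiset.map_add, Multiset.sum_add, sum_map_bind, sum_map_fbind, sum_map_mbind, Multiset.map_map,
            Function.comp_def, nds_bump]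
          -- the six blocks
          have h1 : ∑ i ∈ range L.length, ((run Cov trig f c legs obs M
                ⟨L.eraseIdx i, g.nchi, g.vxs, g.lab, p ::ₘ g.pcs, g.nw + (trig p).toNat⟩ rest done).map
                fun o => nds obs M legs ρ W (o.scale p ((Cov p *ᵥ u) ⬝ᵥ L.getD i 0))).sum
              ≤ (L.length : ℝ) * (ρ p * W ^ (R - 1)) :=
            (Finset.sum_le_sum fun i _ => hblk p _ _ rest done (rpot_pair obs M _ rest done hp i _ _) (hI1 i) hd).trans
              (by rw [Finset.sum_const, Finset.card_range, nsmul_eq_mul])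
          have h2 : ∑ j ∈ rest.attach, ∑ i ∈ range (obs j).length, ((run Cov trig f c legs obs M
                ⟨L ++ (obs j).eraseIdx i, g.nchi, g.vxs, g.lab ∪ {j.1}, p ::ₘ g.pcs, g.nw + (trig p).toNat⟩
                (rest.erase j) done).map
                fun o => nds obs M legs ρ W (o.scale p ((Cov p *ᵥ u) ⬝ᵥ (obs j).getD i 0))).sum
              ≤ ((∑ j ∈ rest, (obs j).length : ℕ) : ℝ) * (ρ p * W ^ (R - 1)) := by
            calc _ ≤ ∑ j ∈ rest.attach, (((obs j).length : ℕ) : ℝ) * (ρ p * W ^ (R - 1)) :=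
                  Finset.sum_le_sum fun j _ => (Finset.sum_le_sum fun i _ =>
                    hblk p _ _ _ done (rpot_pristine obs M _ rest done hp j.2 i _ _ _) (hI2 j.1 i) hd).trans
                      (by rw [Finset.sum_const, Finset.card_range, nsmul_eq_mul])
              _ = ((∑ j ∈ rest, (obs j).length : ℕ) : ℝ) * (ρ p * W ^ (R - 1)) := by
                  rw [Finset.sum_attach rest (fun j => (((obs j).length : ℕ) : ℝ) * (ρ p * W ^ (R - 1))),
                    ← Finset.sum_mul, Nat.cast_sum]
          have h3 : (done.attach.map fun h => ∑ i ∈ range h.1.pend.length, ((run Cov trig f c legs obs M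
                (WGrp.absorb trig L g h.1 i p) rest (done.erase h.1)).map
                fun o => nds obs M legs ρ W (o.scale p ((Cov p *ᵥ u) ⬝ᵥ h.1.pend.getD i 0))).sum).sum
              ≤ (((done.map fun h => h.pend.length).sum : ℕ) : ℝ) * (ρ p * W ^ (R - 1)) := by
            calc _ ≤ (done.attach.map fun h => ((h.1.pend.length : ℕ) : ℝ) * (ρ p * W ^ (R - 1))).sum :=
                  Multiset.sum_map_le_sum_map _ _ fun h _ => (Finset.sum_le_sum fun i _ =>
                    hblk p _ _ rest _ (rpot_absorb obs M _ rest done trig hp h.2 i p) (hI3 h.1 h.2 i p)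
                      (hI3' h.1)).trans
                      (by rw [Finset.sum_const, Finset.card_range, nsmul_eq_mul])
              _ = (done.map fun h => ((h.pend.length : ℕ) : ℝ) * (ρ p * W ^ (R - 1))).sum :=
                  congrArg Multiset.sum
                    (Multiset.attach_map_val' done (fun h => ((h.pend.length : ℕ) : ℝ) * (ρ p * W ^ (R - 1))))
              _ = (((done.map fun h => h.pend.length).sum : ℕ) : ℝ) * (ρ p * W ^ (R - 1)) := by
                  rw [Multiset.sum_map_mul_right, Nat.cast_multiset_sum, Multiset.map_map]
                  rfl
          have h4 : ((run Cov trig f c legs obs M ⟨L, g.nchi, g.vxs, g.lab, p ::ₘ g.pcs, g.nw + (trig p).toNat⟩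
                rest done).map fun o => nds obs M legs ρ W (o.scale p ((Cov p *ᵥ u) ⬝ᵥ f))).sum
              ≤ ρ p * W ^ (R - 1) := hblk p _ _ rest done (rpot_drop obs M _ rest done hp _ _ _) hL hd
          have h5 : ((run Cov trig f c legs obs M ⟨L, g.nchi + 1, g.vxs, g.lab, p ::ₘ g.pcs, g.nw + (trig p).toNat⟩
                rest done).map fun o => nds obs M legs ρ W (o.push p (Cov p *ᵥ u))).sum
              ≤ ρ p * W ^ (R - 1) := hpsh p _ _ rest done (rpot_drop obs M _ rest done hp _ _ _) hL hd
          -- the vertices: only the (vertex, leg) pairs coupled to `C_p u` contribute — `Np p` of them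
          have h6 : ∑ m, ∑ j ∈ range (legs m).length, ((run Cov trig f c legs obs M
                ⟨L ++ (legs m).eraseIdx j, g.nchi, m ::ₘ g.vxs, g.lab, p ::ₘ g.pcs, g.nw + (trig p).toNat⟩ rest done).map
                fun o => nds obs M legs ρ W (o.scale p (-(c m * ((Cov p *ᵥ u) ⬝ᵥ (legs m).getD j 0))))).sum
              ≤ (Np p : ℝ) * (ρ p * W ^ (R - 1)) := by
            have hmj : ∀ m, ∀ j ∈ range (legs m).length, ((run Cov trig f c legs obs M
                ⟨L ++ (legs m).eraseIdx j, g.nchi, m ::ₘ g.vxs, g.lab, p ::ₘ g.pcs, g.nw + (trig p).toNat⟩ rest done).map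
                fun o => nds obs M legs ρ W (o.scale p (-(c m * ((Cov p *ᵥ u) ⬝ᵥ (legs m).getD j 0))))).sum
                  ≤ (if (Cov p *ᵥ u) ⬝ᵥ (legs m).getD j 0 ≠ 0 then 1 else 0) * (ρ p * W ^ (R - 1)) := by
              intro m j _
              by_cases hb : (Cov p *ᵥ u) ⬝ᵥ (legs m).getD j 0 = 0
              · rw [hb, mul_zero, neg_zero, hblk0, if_neg (not_not.2 rfl), zero_mul]
              · rw [if_pos hb, one_mul]
                exact hblk p _ _ rest done (rpot_vertex obs M rest done legs hp hnv m j _ _) (hI6 m j) hd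
            calc _ ≤ ∑ m, ∑ j ∈ range (legs m).length,
                    (if (Cov p *ᵥ u) ⬝ᵥ (legs m).getD j 0 ≠ 0 then 1 else 0) * (ρ p * W ^ (R - 1)) :=
                  Finset.sum_le_sum fun m _ => Finset.sum_le_sum fun j hj => hmj m j hj
              _ = (Np p : ℝ) * (ρ p * W ^ (R - 1)) := by
                  rw [hNp, Nat.cast_sum, Finset.sum_mul]
                  refine Finset.sum_congr rfl fun m _ => ?_
                  rw [← Finset.sum_mul, Finset.sum_boole]
          -- the number of unweighted branches is at most `R`
          have e : R = L.length + 1 + 1 + (M - Multiset.card g.vxs) * maxArity legs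
              + ∑ j ∈ rest, (obs j).length + (done.map fun h => h.pend.length).sum := by
            simp only [hRdef, rpot, hp, List.length_cons]
          have hbr : (L.length + (∑ j ∈ rest, (obs j).length) + (done.map fun h => h.pend.length).sum + 1 + 1 : ℕ)
              ≤ R := by omega
          have hbr' : (((L.length : ℕ) : ℝ) + ((∑ j ∈ rest, (obs j).length : ℕ) : ℝ)
              + (((done.map fun h => h.pend.length).sum : ℕ) : ℝ) + 1 + 1) ≤ (R : ℝ) := by exact_mod_cast hbr
          refine (add_le_add (add_le_add (add_le_add (add_le_add (add_le_add h1 h2) h3) h4) h5) h6).trans ?_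
          calc _ = ρ p * ((((L.length : ℕ) : ℝ) + ((∑ j ∈ rest, (obs j).length : ℕ) : ℝ)
                + (((done.map fun h => h.pend.length).sum : ℕ) : ℝ) + 1 + 1) * W ^ (R - 1))
                + ρ p * (Np p : ℝ) * W ^ (R - 1) := by ring
            _ ≤ ρ p * ((R : ℝ) * W ^ (R - 1)) + ρ p * (Np p : ℝ) * W ^ (R - 1) :=
                add_le_add (mul_le_mul_of_nonneg_left (mul_le_mul_of_nonneg_right hbr' hE0) (hρ p)) le_rfl
            _ = _ := by ring
      -- sum over the pieces: those seeing the leg (`ρ₀`) and the weighted vertex legs (`ρ₁`)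
      · have hsum : ∑ p, (if Cov p *ᵥ u ≠ 0 then ρ p else 0) ≤ ρ₀ := by
          rw [← Finset.sum_filter]; exact hρ₀ u hu
        have hsumN : ∑ p, ρ p * (Np p : ℝ) ≤ ρ₁ := hρN u hu
        calc ∑ p, ((if Cov p *ᵥ u ≠ 0 then ρ p else 0) * (R : ℝ) + ρ p * (Np p : ℝ)) * W ^ (R - 1)
            = ((∑ p, (if Cov p *ᵥ u ≠ 0 then ρ p else 0)) * (R : ℝ) + ∑ p, ρ p * (Np p : ℝ)) * W ^ (R - 1) := by
              rw [Finset.sum_mul, ← Finset.sum_add_distrib, Finset.sum_mul]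
          _ ≤ (ρ₀ * (R : ℝ) + ρ₁) * W ^ (R - 1) :=
              mul_le_mul_of_nonneg_right (add_le_add (mul_le_mul_of_nonneg_right hsum (Nat.cast_nonneg _)) hsumN) hE0
          _ ≤ W * W ^ (R - 1) := mul_le_mul_of_nonneg_right hW hE0
          _ = W ^ R := by rw [← pow_succ', Nat.sub_add_cancel hR]

/-- **Consistency with gen 18**: the uniform locality `N_p(u) ≤ N₀` with `ρ₀·(rpot + N₀) ≤ W` gives the weighted
hypotheses with `ρ₁ = ρ₀·N₀`, so `run_lsum_le_W` contains `BIJ88WalkLocalCount312.run_lsum_le`.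
[cite: BalabanImbrieJaffe1988, §5.14 p.311–312] -/
theorem run_lsum_le_of_uniform {N₀ : ℕ} (hobs : ∀ j, ∀ w ∈ obs j, w ∈ Dir) (hlegs : ∀ m, ∀ w ∈ legs m, w ∈ Dir)
    (hρ : ∀ p, 0 ≤ ρ p) (hρ₀ : ∀ u ∈ Dir, (∑ p ∈ univ.filter (fun p => Cov p *ᵥ u ≠ 0), ρ p) ≤ ρ₀)
    (hN : ∀ p, ∀ u ∈ Dir,
      (∑ m, ((range (legs m).length).filter fun j => (Cov p *ᵥ u) ⬝ᵥ (legs m).getD j 0 ≠ 0).card) ≤ N₀)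
    (g : WGrp S κ ι P) (rest : Finset κ) (done : Multiset (WGrp S κ ι P))
    (hg : ∀ w ∈ g.pend, w ∈ Dir) (hd : ∀ h ∈ done, ∀ w ∈ h.pend, w ∈ Dir) {W : ℝ} (hW1 : 1 ≤ W)
    (hW : ρ₀ * ((rpot obs M (maxArity legs) g rest done + N₀ : ℕ) : ℝ) ≤ W) :
    ((run Cov trig f c legs obs M g rest done).map (nds obs M legs ρ W)).sum
      ≤ W ^ rpot obs M (maxArity legs) g rest done := by
  -- a piece not seeing `u` couples to no leg, so the weighted count is over the pieces seeing `u`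
  have hρN : ∀ u ∈ Dir, (∑ p, ρ p *
      ((∑ m, ((range (legs m).length).filter fun j => (Cov p *ᵥ u) ⬝ᵥ (legs m).getD j 0 ≠ 0).card : ℕ) : ℝ))
        ≤ ρ₀ * N₀ := by
    intro u hu
    have hz : ∀ p, Cov p *ᵥ u = 0 →
        (∑ m, ((range (legs m).length).filter fun j => (Cov p *ᵥ u) ⬝ᵥ (legs m).getD j 0 ≠ 0).card) = 0 :=
      fun p hp => Finset.sum_eq_zero fun m _ => by
        rw [Finset.card_eq_zero, Finset.filter_eq_empty_iff]
        intro j _ h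
        exact h (by rw [hp, zero_dotProduct])
    calc ∑ p, ρ p * ((∑ m, ((range (legs m).length).filter
            fun j => (Cov p *ᵥ u) ⬝ᵥ (legs m).getD j 0 ≠ 0).card : ℕ) : ℝ)
        = ∑ p ∈ univ.filter (fun p => Cov p *ᵥ u ≠ 0), ρ p * ((∑ m, ((range (legs m).length).filter
            fun j => (Cov p *ᵥ u) ⬝ᵥ (legs m).getD j 0 ≠ 0).card : ℕ) : ℝ) := by
          rw [Finset.sum_filter]
          refine Finset.sum_congr rfl fun p _ => ?_
          by_cases hp : Cov p *ᵥ u = 0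
          · rw [if_neg (not_not.2 hp), hz p hp, Nat.cast_zero, mul_zero]
          · rw [if_pos hp]
      _ ≤ ∑ p ∈ univ.filter (fun p => Cov p *ᵥ u ≠ 0), ρ p * (N₀ : ℝ) :=
          Finset.sum_le_sum fun p _ => mul_le_mul_of_nonneg_left (by exact_mod_cast hN p u hu) (hρ p)
      _ ≤ ρ₀ * N₀ := by rw [← Finset.sum_mul]; exact mul_le_mul_of_nonneg_right (hρ₀ u hu) (Nat.cast_nonneg _)
  refine run_lsum_le_W hobs hlegs hρ hρ₀ hρN _ g rest done (Nat.lt_succ_self _) hg hd W hW1 ?_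
  calc ρ₀ * (rpot obs M (maxArity legs) g rest done : ℝ) + ρ₀ * N₀
      = ρ₀ * ((rpot obs M (maxArity legs) g rest done + N₀ : ℕ) : ℝ) := by push_cast; ring
    _ ≤ W := hW

end Run

end Literature.MathematicalPhysics.QuantumFieldTheory.BalabanImbrieJaffe1984to88.BIJ88WalkLocalCountW312

end
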